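import Summits.Ventures.LatticeQCDFlow.Scaling.DominatedStarMixingCeiling
import Summits.Ventures.LatticeQCDFlow.Scaling.HubCollectorLaw

/-!
HONEST FRAMING: exact (Metropolis-corrected) sampling algorithms for lattice gauge theory; figures
of merit are autocorrelation/cost numbers at stated couplings and volumes; no continuum-physics
claim.

# DominatedStarMixingLaw — THE `K·log K` LAW FROM BOTH SIDES FOR THE MAP-ASSISTED HOT-REFRESHED HUB WITHOUT PERFECT
# TRANSPORTS: UNDER ONE-SIDED DOMINATION `p·μ_l(φ_r u) ≤ μ_0(u)` AND `4t ≤ p(1−t)w_0`, FROM A RARE COLD START,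
# `(K/θ_Σ − 1)·log(K/4) ≤ t_mix(1/4) ≤ ⌈(2m/(tcp))·log(4(2K+p)/p)⌉` WITH `θ_Σ = t + (1−t)(1−w_0) ≤ 1`; WITH PERFECT
# TRANSPORTS (ANY LAWS, MAPS, WEIGHTS) `(K/θ_Σ − 1)·log(K/4) ≤ t_mix(1/4) ≤ ⌈(2m/(t(1−t)w_0c))·log(8(K+1))⌉`
# (lean-2 GEN-26, ours)

Venture-side (OURS).  Cell `lqcd-flow` (pub-lqcd), unit `pub-lqcd-lean-2-g26`, 2026-08-27.  Chapter M (the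
coupon-collector ceiling without perfect transports), file 10 — the two-sided law.  THE SCHEME is that of
`Scaling/DominatedStarMixingCeiling`: `P = t·GSw + (1−t)·Π_w^M` on `Fin (K+1) → S`, hub list `e_r = (0, κ_r+1)` of
length `m` (multiplicity of every cold level `≥ c ≥ 1`) with bijections `φ_r`, positive unit-mass laws `μ_k`, update
weights `w`, the EXACT hot sampler `M_0(u,·) = μ_0` and `μ_k`-REVERSIBLE row-stochastic cold kernels (reversibility is
what the collector floor of `Scaling/HubCollectorLaw` asks; the ceiling only uses the stationarity it implies).  The
floor of chapter L holds for every maps, allocation and cold kernels from a configuration rare at the cold levels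
(`Σ_k μ_{k+1}(x_{k+1}) ≤ 1/4`); the ceiling of chapter M holds under one-sided domination in the regime
`4t ≤ p(1−t)w_0`; this file puts them side by side, and supplies the rare start when `|S| ≥ 4K`.

## What is proved

* §1 **`dominatedStar_mixingTime_two_sided`** — `K ≥ 2`, `0 < t ≤ 1`, `0 < p ≤ 1`, `p·μ_{l_r}(φ_r u) ≤ μ_0(u)`,
  `4t ≤ p(1−t)w_0`, a configuration `x` with `Σ_k μ_{k+1}(x_{k+1}) ≤ 1/4`:
  **`(K/(t + (1−t)(1−w_0)) − 1)·log(K/4) ≤ t_mix(1/4) ≤ ⌈(2m/(tcp))·log((2K+p)/(p/4))⌉`**;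
  `dominatedStar_mixingTime_two_sided_linearLog` — `K ≥ 4`: the floor in the form `(K − 1)·log(K/4)`;
  `dominatedStar_mixingTime_two_sided_of_card` — `|S| ≥ 4K`: the rare start supplied.
* §2 **`perfectStar_mixingTime_two_sided`** — perfect transports `μ_{l_r}(φ_r u) = μ_0(u)`, `0 < t < 1`, `w_0 > 0`, any
  laws, maps and weights: **`(K/(t + (1−t)(1−w_0)) − 1)·log(K/4) ≤ t_mix(1/4) ≤ ⌈(2m/(t(1−t)w_0c))·log(2(K+1)/(1/4))⌉`**;
  `perfectStar_mixingTime_two_sided_of_card`.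

Reading (no numerics implied): for the hot-refreshed hub with a one-sidedly dominating learned transport the mixing
time from a generic cold start is pinned between `(K/θ_Σ − 1)·log(K/4)` and `(2m/(tcp))·log(4(2K+p)/p)`: at `m = cK`
both sides are order `K·log K`, the transport quality `p` and the swap fraction enter the constants only.  NOT
CLAIMED: matching constants (the two sides differ by `≈ 2θ_Σ m/(tcpK)`), anything outside the regime
`4t ≤ p(1−t)w_0` for imperfect transports, anything measured.  Literature grade (cell rule): OWN RESULT (composition of
the tree's `hubList_mixingTime_ge_quarter` and `dominatedStar_mixingTime_le`); nothing cited as a fact; no new bib keys.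
-/

noncomputable section

open Finset Function
open Literature.Probability.MarkovChains

namespace Summit.Ventures.LatticeQCDFlow.Scaling

variable {S : Type*} [Fintype S] [DecidableEq S] {K m : ℕ} {μ : Fin (K + 1) → S → ℝ} {M : Fin (K + 1) → S → S → ℝ}
  {w : Fin (K + 1) → ℝ} {t p : ℝ}

section Law
variable (κ : Fin m → Fin K) (φ : Fin m → Equiv.Perm S)

/-- The touch-rate sum `θ_Σ = t + (1−t)(1−w_0)` is positive as soon as `0 < t ≤ 1` and `w_0 ≤ 1`. [ours] -/
theorem touchRateSum_pos (ht0 : 0 < t) (ht1 : t ≤ 1) (hw01 : w 0 ≤ 1) : 0 < t + (1 - t) * (1 - w 0) := by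
  nlinarith

/-- A probability vector of weights has `w_0 ≤ 1`. [ours] -/
theorem weight_zero_le_one (hw0 : ∀ k, 0 ≤ w k) (hw1 : ∑ k, w k = 1) : w 0 ≤ 1 := by
  have h := Finset.single_le_sum (f := w) (fun k _ => hw0 k) (mem_univ (0 : Fin (K + 1)))
  rw [hw1] at h; exact h

/-! ## §1 One-sided domination: the law from both sides -/

/-- **THE `K·log K` LAW WITHOUT PERFECT TRANSPORTS, BOTH SIDES:** `K ≥ 2`, `m ≥ 1`, `0 < t ≤ 1`, positive unit-mass
laws `μ_k`, `μ_k`-reversible row-stochastic cold kernels, the exact hot sampler `M_0(u,·) = μ_0`, one-sided domination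
`p·μ_{l_r}(φ_r u) ≤ μ_0(u)` with `0 < p ≤ 1`, the regime `4t ≤ p(1−t)w_0`, every cold level listed `≥ c ≥ 1` times, a
configuration `x` with `Σ_k μ_{k+1}(x_{k+1}) ≤ 1/4`:
**`(K/(t + (1−t)(1−w_0)) − 1)·log(K/4) ≤ t_mix(1/4) ≤ ⌈(2m/(tcp))·log((2K+p)/(p·(1/4)))⌉`.** [ours] -/
theorem dominatedStar_mixingTime_two_sided (hK : 2 ≤ K) (hm : 1 ≤ m) (ht0 : 0 < t) (ht1 : t ≤ 1) (hw0 : ∀ k, 0 ≤ w k)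
    (hw1 : ∑ k, w k = 1) (hμ : ∀ k x, 0 < μ k x) (hμ1 : ∀ k, ∑ u, μ k u = 1) (hM : ∀ k, IsRowStochastic (M k))
    (hMrev : ∀ k, DetailedBalance (μ k) (M k)) (hM0 : ∀ u v, M 0 u v = μ 0 v) (hp0 : 0 < p) (hp1 : p ≤ 1)
    (hdom : ∀ r u, p * μ (κ r).succ (φ r u) ≤ μ 0 u) (hreg : 4 * t ≤ p * (1 - t) * w 0)
    {c : ℕ} (hc1 : 1 ≤ c) (hc : ∀ p' : Fin K, c ≤ (univ.filter (fun r : Fin m => κ r = p')).card) (hcm : c ≤ m)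
    (x : Fin (K + 1) → S) (hx : ∑ k : Fin K, μ k.succ (x k.succ) ≤ 1 / 4) :
    ((K : ℝ) / (t + (1 - t) * (1 - w 0)) - 1) * Real.log (K / 4)
        ≤ (mixingTime (fun y z : Fin (K + 1) → S =>
            t * ptGraphSwap μ (fun r : Fin m => (((0 : Fin (K + 1)), (κ r).succ) : Fin (K + 1) × Fin (K + 1))) φ y z
              + (1 - t) * prodKernel w M y z) (tensorFun μ) (1 / 4) : ℝ) ∧
      mixingTime (fun y z : Fin (K + 1) → S =>
            t * ptGraphSwap μ (fun r : Fin m => (((0 : Fin (K + 1)), (κ r).succ) : Fin (K + 1) × Fin (K + 1))) φ y z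
              + (1 - t) * prodKernel w M y z) (tensorFun μ) (1 / 4)
        ≤ ⌈2 * (m : ℝ) / (t * c * p) * Real.log ((2 * (K : ℝ) + p) / (p * (1 / 4)))⌉₊ := by
  have hstat : ∀ k : Fin (K + 1), k ≠ 0 → ∀ v, ∑ u, μ k u * M k u v = μ k v :=
    fun k _ v => (hMrev k).isStationary (hM k).2 v
  refine ⟨?_, dominatedStar_mixingTime_le κ φ hm ht0 ht1 hw0 hw1 hμ hμ1 hM hM0 hstat hp0 hp1 hdom hreg hc1 hc hcm
    (by norm_num)⟩
  have hmix : ∃ t₀, worstTvDist (fun y z : Fin (K + 1) → S =>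
      t * ptGraphSwap μ (fun r : Fin m => (((0 : Fin (K + 1)), (κ r).succ) : Fin (K + 1) × Fin (K + 1))) φ y z
        + (1 - t) * prodKernel w M y z) (tensorFun μ) t₀ ≤ 1 / 4 :=
    ⟨_, dominatedStar_worstTvDist_le_of_ge_log κ φ hm ht0 ht1 hw0 hw1 hμ hμ1 hM hM0 hstat hp0 hp1 hdom hreg hc1 hc hcm
      (by norm_num : (0:ℝ) < 1 / 4) (Nat.le_ceil _)⟩
  exact hubList_mixingTime_ge_quarter κ φ hK hm hμ hμ1 hM hMrev hw0 hw1 ht0.le ht1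
    (touchRateSum_pos ht0 ht1 (weight_zero_le_one hw0 hw1)) x hx hmix

/-- **THE LINEAR-LOG FORM (`K ≥ 4`): `(K − 1)·log(K/4) ≤ t_mix(1/4) ≤ ⌈(2m/(tcp))·log((2K+p)/(p·(1/4)))⌉`** — the
floor freed of `t` and `w_0` (since `θ_Σ ≤ 1`). [ours] -/
theorem dominatedStar_mixingTime_two_sided_linearLog (hK : 4 ≤ K) (hm : 1 ≤ m) (ht0 : 0 < t) (ht1 : t ≤ 1)
    (hw0 : ∀ k, 0 ≤ w k) (hw1 : ∑ k, w k = 1) (hμ : ∀ k x, 0 < μ k x) (hμ1 : ∀ k, ∑ u, μ k u = 1)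
    (hM : ∀ k, IsRowStochastic (M k)) (hMrev : ∀ k, DetailedBalance (μ k) (M k)) (hM0 : ∀ u v, M 0 u v = μ 0 v)
    (hp0 : 0 < p) (hp1 : p ≤ 1) (hdom : ∀ r u, p * μ (κ r).succ (φ r u) ≤ μ 0 u) (hreg : 4 * t ≤ p * (1 - t) * w 0)
    {c : ℕ} (hc1 : 1 ≤ c) (hc : ∀ p' : Fin K, c ≤ (univ.filter (fun r : Fin m => κ r = p')).card) (hcm : c ≤ m)
    (x : Fin (K + 1) → S) (hx : ∑ k : Fin K, μ k.succ (x k.succ) ≤ 1 / 4) :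
    ((K : ℝ) - 1) * Real.log (K / 4)
        ≤ (mixingTime (fun y z : Fin (K + 1) → S =>
            t * ptGraphSwap μ (fun r : Fin m => (((0 : Fin (K + 1)), (κ r).succ) : Fin (K + 1) × Fin (K + 1))) φ y z
              + (1 - t) * prodKernel w M y z) (tensorFun μ) (1 / 4) : ℝ) ∧
      mixingTime (fun y z : Fin (K + 1) → S =>
            t * ptGraphSwap μ (fun r : Fin m => (((0 : Fin (K + 1)), (κ r).succ) : Fin (K + 1) × Fin (K + 1))) φ y z
              + (1 - t) * prodKernel w M y z) (tensorFun μ) (1 / 4)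
        ≤ ⌈2 * (m : ℝ) / (t * c * p) * Real.log ((2 * (K : ℝ) + p) / (p * (1 / 4)))⌉₊ := by
  have hstat : ∀ k : Fin (K + 1), k ≠ 0 → ∀ v, ∑ u, μ k u * M k u v = μ k v :=
    fun k _ v => (hMrev k).isStationary (hM k).2 v
  refine ⟨?_, dominatedStar_mixingTime_le κ φ hm ht0 ht1 hw0 hw1 hμ hμ1 hM hM0 hstat hp0 hp1 hdom hreg hc1 hc hcm
    (by norm_num)⟩
  have hmix : ∃ t₀, worstTvDist (fun y z : Fin (K + 1) → S =>
      t * ptGraphSwap μ (fun r : Fin m => (((0 : Fin (K + 1)), (κ r).succ) : Fin (K + 1) × Fin (K + 1))) φ y z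
        + (1 - t) * prodKernel w M y z) (tensorFun μ) t₀ ≤ 1 / 4 :=
    ⟨_, dominatedStar_worstTvDist_le_of_ge_log κ φ hm ht0 ht1 hw0 hw1 hμ hμ1 hM hM0 hstat hp0 hp1 hdom hreg hc1 hc hcm
      (by norm_num : (0:ℝ) < 1 / 4) (Nat.le_ceil _)⟩
  exact hubList_mixingTime_ge_linearLog κ φ hK hm hμ hμ1 hM hMrev hw0 hw1 ht0.le ht1
    (touchRateSum_pos ht0 ht1 (weight_zero_le_one hw0 hw1)) x hx hmix

/-- **THE LAW ON A LARGE CONFIGURATION SPACE (`|S| ≥ 4K`, `K ≥ 4`):** the rare start supplied —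
**`(K − 1)·log(K/4) ≤ t_mix(1/4) ≤ ⌈(2m/(tcp))·log((2K+p)/(p·(1/4)))⌉`.** [ours] -/
theorem dominatedStar_mixingTime_two_sided_of_card (hK : 4 ≤ K) (hS : 4 * K ≤ Fintype.card S) (hm : 1 ≤ m)
    (ht0 : 0 < t) (ht1 : t ≤ 1) (hw0 : ∀ k, 0 ≤ w k) (hw1 : ∑ k, w k = 1) (hμ : ∀ k x, 0 < μ k x)
    (hμ1 : ∀ k, ∑ u, μ k u = 1) (hM : ∀ k, IsRowStochastic (M k)) (hMrev : ∀ k, DetailedBalance (μ k) (M k))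
    (hM0 : ∀ u v, M 0 u v = μ 0 v) (hp0 : 0 < p) (hp1 : p ≤ 1) (hdom : ∀ r u, p * μ (κ r).succ (φ r u) ≤ μ 0 u)
    (hreg : 4 * t ≤ p * (1 - t) * w 0) {c : ℕ} (hc1 : 1 ≤ c)
    (hc : ∀ p' : Fin K, c ≤ (univ.filter (fun r : Fin m => κ r = p')).card) (hcm : c ≤ m) :
    ((K : ℝ) - 1) * Real.log (K / 4)
        ≤ (mixingTime (fun y z : Fin (K + 1) → S =>
            t * ptGraphSwap μ (fun r : Fin m => (((0 : Fin (K + 1)), (κ r).succ) : Fin (K + 1) × Fin (K + 1))) φ y z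
              + (1 - t) * prodKernel w M y z) (tensorFun μ) (1 / 4) : ℝ) ∧
      mixingTime (fun y z : Fin (K + 1) → S =>
            t * ptGraphSwap μ (fun r : Fin m => (((0 : Fin (K + 1)), (κ r).succ) : Fin (K + 1) × Fin (K + 1))) φ y z
              + (1 - t) * prodKernel w M y z) (tensorFun μ) (1 / 4)
        ≤ ⌈2 * (m : ℝ) / (t * c * p) * Real.log ((2 * (K : ℝ) + p) / (p * (1 / 4)))⌉₊ := by
  obtain ⟨x, hx⟩ := exists_rare_coldStart (μ := μ) hμ1 hS
  exact dominatedStar_mixingTime_two_sided_linearLog κ φ hK hm ht0 ht1 hw0 hw1 hμ hμ1 hM hMrev hM0 hp0 hp1 hdom hreg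
    hc1 hc hcm x hx

/-! ## §2 Perfect transports: arbitrary laws, maps and update weights -/

/-- **THE `K·log K` LAW WITH PERFECT TRANSPORTS AND GENERAL UPDATE WEIGHTS, BOTH SIDES:** `K ≥ 2`, `m ≥ 1`,
`0 < t < 1`, `w_0 > 0`, positive unit-mass laws, `μ_k`-reversible row-stochastic cold kernels, exact hot sampler, perfect
transports `μ_{l_r}(φ_r u) = μ_0(u)` on every hub edge, every cold level listed `≥ c ≥ 1` times, a configuration `x`
with `Σ_k μ_{k+1}(x_{k+1}) ≤ 1/4`:
**`(K/(t + (1−t)(1−w_0)) − 1)·log(K/4) ≤ t_mix(1/4) ≤ ⌈(2m/(t(1−t)w_0c))·log(2(K+1)/(1/4))⌉`.** [ours] -/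
theorem perfectStar_mixingTime_two_sided (hK : 2 ≤ K) (hm : 1 ≤ m) (ht0 : 0 < t) (ht1 : t < 1) (hw0 : ∀ k, 0 ≤ w k)
    (hw00 : 0 < w 0) (hw1 : ∑ k, w k = 1) (hμ : ∀ k x, 0 < μ k x) (hμ1 : ∀ k, ∑ u, μ k u = 1)
    (hM : ∀ k, IsRowStochastic (M k)) (hMrev : ∀ k, DetailedBalance (μ k) (M k)) (hM0 : ∀ u v, M 0 u v = μ 0 v)
    (hperf : ∀ r u, μ (κ r).succ (φ r u) = μ 0 u) {c : ℕ} (hc1 : 1 ≤ c)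
    (hc : ∀ p' : Fin K, c ≤ (univ.filter (fun r : Fin m => κ r = p')).card) (hcm : c ≤ m)
    (x : Fin (K + 1) → S) (hx : ∑ k : Fin K, μ k.succ (x k.succ) ≤ 1 / 4) :
    ((K : ℝ) / (t + (1 - t) * (1 - w 0)) - 1) * Real.log (K / 4)
        ≤ (mixingTime (fun y z : Fin (K + 1) → S =>
            t * ptGraphSwap μ (fun r : Fin m => (((0 : Fin (K + 1)), (κ r).succ) : Fin (K + 1) × Fin (K + 1))) φ y z
              + (1 - t) * prodKernel w M y z) (tensorFun μ) (1 / 4) : ℝ) ∧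
      mixingTime (fun y z : Fin (K + 1) → S =>
            t * ptGraphSwap μ (fun r : Fin m => (((0 : Fin (K + 1)), (κ r).succ) : Fin (K + 1) × Fin (K + 1))) φ y z
              + (1 - t) * prodKernel w M y z) (tensorFun μ) (1 / 4)
        ≤ ⌈2 * (m : ℝ) / (t * (1 - t) * w 0 * c) * Real.log (2 * ((K : ℝ) + 1) / (1 / 4))⌉₊ := by
  have hstat : ∀ k : Fin (K + 1), k ≠ 0 → ∀ v, ∑ u, μ k u * M k u v = μ k v :=
    fun k _ v => (hMrev k).isStationary (hM k).2 v
  refine ⟨?_, perfectStar_mixingTime_le κ φ hm ht0 ht1 hw0 hw00 hw1 hμ hμ1 hM hM0 hstat hperf hc1 hc hcm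
    (by norm_num)⟩
  have hmix : ∃ t₀, worstTvDist (fun y z : Fin (K + 1) → S =>
      t * ptGraphSwap μ (fun r : Fin m => (((0 : Fin (K + 1)), (κ r).succ) : Fin (K + 1) × Fin (K + 1))) φ y z
        + (1 - t) * prodKernel w M y z) (tensorFun μ) t₀ ≤ 1 / 4 :=
    ⟨_, perfectStar_worstTvDist_le_of_ge_log κ φ hm ht0 ht1 hw0 hw00 hw1 hμ hμ1 hM hM0 hstat hperf hc1 hc hcm
      (by norm_num : (0:ℝ) < 1 / 4) (Nat.le_ceil _)⟩
  exact hubList_mixingTime_ge_quarter κ φ hK hm hμ hμ1 hM hMrev hw0 hw1 ht0.le ht1.le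
    (touchRateSum_pos ht0 ht1.le (weight_zero_le_one hw0 hw1)) x hx hmix

/-- **PERFECT TRANSPORTS ON A LARGE CONFIGURATION SPACE (`|S| ≥ 4K`, `K ≥ 4`):**
**`(K − 1)·log(K/4) ≤ t_mix(1/4) ≤ ⌈(2m/(t(1−t)w_0c))·log(2(K+1)/(1/4))⌉`.** [ours] -/
theorem perfectStar_mixingTime_two_sided_of_card (hK : 4 ≤ K) (hS : 4 * K ≤ Fintype.card S) (hm : 1 ≤ m)
    (ht0 : 0 < t) (ht1 : t < 1) (hw0 : ∀ k, 0 ≤ w k) (hw00 : 0 < w 0) (hw1 : ∑ k, w k = 1) (hμ : ∀ k x, 0 < μ k x)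
    (hμ1 : ∀ k, ∑ u, μ k u = 1) (hM : ∀ k, IsRowStochastic (M k)) (hMrev : ∀ k, DetailedBalance (μ k) (M k))
    (hM0 : ∀ u v, M 0 u v = μ 0 v) (hperf : ∀ r u, μ (κ r).succ (φ r u) = μ 0 u) {c : ℕ} (hc1 : 1 ≤ c)
    (hc : ∀ p' : Fin K, c ≤ (univ.filter (fun r : Fin m => κ r = p')).card) (hcm : c ≤ m) :
    ((K : ℝ) - 1) * Real.log (K / 4)
        ≤ (mixingTime (fun y z : Fin (K + 1) → S =>
            t * ptGraphSwap μ (fun r : Fin m => (((0 : Fin (K + 1)), (κ r).succ) : Fin (K + 1) × Fin (K + 1))) φ y z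
              + (1 - t) * prodKernel w M y z) (tensorFun μ) (1 / 4) : ℝ) ∧
      mixingTime (fun y z : Fin (K + 1) → S =>
            t * ptGraphSwap μ (fun r : Fin m => (((0 : Fin (K + 1)), (κ r).succ) : Fin (K + 1) × Fin (K + 1))) φ y z
              + (1 - t) * prodKernel w M y z) (tensorFun μ) (1 / 4)
        ≤ ⌈2 * (m : ℝ) / (t * (1 - t) * w 0 * c) * Real.log (2 * ((K : ℝ) + 1) / (1 / 4))⌉₊ := by
  have hstat : ∀ k : Fin (K + 1), k ≠ 0 → ∀ v, ∑ u, μ k u * M k u v = μ k v :=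
    fun k _ v => (hMrev k).isStationary (hM k).2 v
  obtain ⟨x, hx⟩ := exists_rare_coldStart (μ := μ) hμ1 hS
  refine ⟨?_, perfectStar_mixingTime_le κ φ hm ht0 ht1 hw0 hw00 hw1 hμ hμ1 hM hM0 hstat hperf hc1 hc hcm
    (by norm_num)⟩
  have hmix : ∃ t₀, worstTvDist (fun y z : Fin (K + 1) → S =>
      t * ptGraphSwap μ (fun r : Fin m => (((0 : Fin (K + 1)), (κ r).succ) : Fin (K + 1) × Fin (K + 1))) φ y z
        + (1 - t) * prodKernel w M y z) (tensorFun μ) t₀ ≤ 1 / 4 :=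
    ⟨_, perfectStar_worstTvDist_le_of_ge_log κ φ hm ht0 ht1 hw0 hw00 hw1 hμ hμ1 hM hM0 hstat hperf hc1 hc hcm
      (by norm_num : (0:ℝ) < 1 / 4) (Nat.le_ceil _)⟩
  exact hubList_mixingTime_ge_linearLog κ φ hK hm hμ hμ1 hM hMrev hw0 hw1 ht0.le ht1.le
    (touchRateSum_pos ht0 ht1.le (weight_zero_le_one hw0 hw1)) x hx hmix

end Law

end Summit.Ventures.LatticeQCDFlow.Scaling

end
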